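import Mathlib.NumberTheory.LSeries.Dirichlet
import Mathlib.NumberTheory.LSeries.Nonvanishing
import Mathlib.NumberTheory.Chebyshev
import Mathlib.NumberTheory.Harmonic.Bounds
import Mathlib.NumberTheory.Harmonic.ZetaAsymp
import Literature.NumberTheory.LFunctions.PerronKernel
import HarnessLib

/-!
# The truncated Perron formula for `ψ(x)` at half-integers (Montgomery–Vaughan Thm. 5.2, Cor. 5.3)

Trunk T-ANT (`NumberTheory/LFunctions`), family RH. Montgomery–Vaughan, *Multiplicative Number
Theory I*, Thm. 5.2 / Cor. 5.3 (truncated Perron formula) specialised to `a_n = Λ(n)`,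
`σ₀ = c = 1 + 1/log x`, `x = N + 1/2` a half-integer and truncation heights `T₁, T₂ ≥ x`:

`∫_{-T₂}^{T₁} (−ζ'/ζ)(c+it) x^{c+it}/(c+it) dt = 2π ψ(x) + O(log² x)`

(`Literature.NumberTheory.LFunctions.exists_norm_perron_vonMangoldt_sub_le`), i.e. `ψ(x) = (1/2πi)∫_{c−iT₂}^{c+iT₁} (−ζ'/ζ)(s) x^s ds/s
+ O(log² x)`. This is the case `T ≍ x` of MV Cor. 5.3,
`R ≪ ∑_{x/2<n<2x} Λ(n) min(1, x/(T|x−n|)) + (4^c + x^c)/T · ∑ Λ(n)/n^c ≪ log² x`, used in the proof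
of MV Thm. 12.5 / 13.1 with `T = x`; taking `x` half-integral makes `ψ₀ = ψ` and `|x − n| ≥ 1/2`.

Ingredients: the L-series `−ζ'/ζ(s) = ∑ Λ(n) n^{-s}` (Mathlib
`ArithmeticFunction.LSeries_vonMangoldt_eq_deriv_riemannZeta_div`), termwise integration
(dominated convergence), the kernel estimate `Literature.NumberTheory.LFunctions.norm_perronIntegral_sub_le`
(`PerronKernel.lean`, MV (5.9)), and the elementary estimate
`∑_n Λ(n) (x/n)^c / |log(x/n)| ≪ x log² x` (`Literature.NumberTheory.LFunctions.exists_perronSum_le`), whose tail uses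
`∑ Λ(n)/n^σ = −ζ'/ζ(σ) ≤ 1/(σ−1) + O(1)` on `1 < σ ≤ 2` (`Literature.NumberTheory.LFunctions.exists_tsum_vonMangoldt_div_rpow_le`,
from Mathlib's entire `riemannZeta₁ = (s−1)ζ(s)`).

## References

* H. L. Montgomery, R. C. Vaughan, *Multiplicative Number Theory I. Classical Theory*, CUP 2007,
  §5.1 Thm. 5.2, Cor. 5.3; §12.1 (proof of Thm. 12.5); §13.1 (proof of Thm. 13.1).
* H. Davenport, *Multiplicative Number Theory*, 2nd ed., GTM 74, Springer 1980, §17.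
-/

noncomputable section

open Complex Set MeasureTheory Filter Topology intervalIntegral Real
open ArithmeticFunction hiding log id
open scoped Chebyshev

namespace Literature.NumberTheory.LFunctions

/-! ### `−ζ'/ζ(s) x^s/s = ∑ Λ(n) (x/n)^s/s` on `Re s > 1` -/

/-- `(x/y)^s = x^s/y^s` for real `x ≥ 0`, `y > 0` and complex `s`. [folklore] -/
lemma ofReal_div_cpow {x y : ℝ} (hx : 0 ≤ x) (hy : 0 < y) (s : ℂ) :
    (((x / y : ℝ)) : ℂ) ^ s = (x : ℂ) ^ s / (y : ℂ) ^ s := by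
  rw [div_eq_mul_inv, ofReal_mul, mul_cpow_ofReal_nonneg hx (inv_nonneg.2 hy.le), ofReal_inv,
    inv_cpow _ _ ?_, div_eq_mul_inv]
  rw [arg_ofReal_of_nonneg hy.le]
  exact Real.pi_ne_zero.symm

/-- **The Dirichlet series of `Λ` against the Perron kernel.** For `x > 0` and `Re s > 1`,
`∑_n Λ(n) (x/n)^s/s = (−ζ'/ζ)(s) · x^s/s` (Mathlib's `−ζ'/ζ = L(Λ, s)`). [folklore] -/
theorem hasSum_vonMangoldt_mul_cpow_div {x : ℝ} (hx : 0 < x) {s : ℂ} (hs : 1 < s.re) :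
    HasSum (fun n : ℕ ↦ (Λ n : ℂ) * ((((x / n : ℝ)) : ℂ) ^ s / s))
      ((-deriv riemannZeta s / riemannZeta s) * ((x : ℂ) ^ s / s)) := by
  have h1 : HasSum (LSeries.term (fun n ↦ (Λ n : ℂ)) s) (LSeries (fun n ↦ (Λ n : ℂ)) s) :=
    (ArithmeticFunction.LSeriesSummable_vonMangoldt hs).hasSum
  rw [ArithmeticFunction.LSeries_vonMangoldt_eq_deriv_riemannZeta_div hs] at h1
  have h2 := h1.mul_right ((x : ℂ) ^ s / s)
  have hfun : (fun n : ℕ ↦ (Λ n : ℂ) * ((((x / n : ℝ)) : ℂ) ^ s / s)) =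
      fun n ↦ LSeries.term (fun n ↦ (Λ n : ℂ)) s n * ((x : ℂ) ^ s / s) := by
    funext n
    rcases Nat.eq_zero_or_pos n with rfl | hn
    · simp
    · rw [LSeries.term_of_ne_zero hn.ne', ofReal_div_cpow hx.le (by exact_mod_cast hn) s]
      push_cast
      ring
  rw [hfun]
  exact h2

/-! ### `∑ Λ(n)/n^σ ≤ 1/(σ − 1) + O(1)` for `1 < σ ≤ 2` -/

/-- The terms of `L(Λ, σ)` for real `σ > 0` are the real numbers `Λ(n)/n^σ`. [folklore] -/
lemma term_vonMangoldt_ofReal {σ : ℝ} (hσ : 0 < σ) (n : ℕ) :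
    LSeries.term (fun n ↦ (Λ n : ℂ)) (σ : ℂ) n = ((Λ n / (n : ℝ) ^ σ : ℝ) : ℂ) := by
  rcases Nat.eq_zero_or_pos n with rfl | hn
  · simp [Real.zero_rpow hσ.ne']
  · rw [LSeries.term_of_ne_zero hn.ne', ofReal_div, ofReal_cpow (Nat.cast_nonneg n)]
    norm_cast

/-- **`−ζ'/ζ(σ) ≤ 1/(σ−1) + K₀` on `1 < σ ≤ 2`.** There is `K₀ ≥ 0` such that for `1 < σ ≤ 2` the
series `∑ Λ(n)/n^σ` converges with sum `≤ 1/(σ − 1) + K₀`: its sum is `−ζ'/ζ(σ) = 1/(σ−1) −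
ζ₁'/ζ₁(σ)` with `ζ₁ = (s−1)ζ(s)` entire and non-zero on `[1, 2]`. (MV Cor. 1.11-type crude bound,
`−ζ'/ζ(σ) = 1/(σ−1) + O(1)`.) [folklore] -/
theorem exists_tsum_vonMangoldt_div_rpow_le :
    ∃ K₀ : ℝ, 0 ≤ K₀ ∧ ∀ σ : ℝ, 1 < σ → σ ≤ 2 →
      Summable (fun n : ℕ ↦ Λ n / (n : ℝ) ^ σ) ∧
        ∑' n : ℕ, Λ n / (n : ℝ) ^ σ ≤ 1 / (σ - 1) + K₀ := by
  -- `ζ₁ ≠ 0` on the real segment `[1, 2]`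
  have hne : ∀ σ ∈ Icc (1 : ℝ) 2, riemannZeta₁ (σ : ℂ) ≠ 0 := by
    intro σ hσ
    rcases hσ.1.eq_or_lt with h | h
    · rw [← h]; simp
    · have hσ1 : (σ : ℂ) ≠ 1 := by
        intro h1; have := congrArg re h1; simp at this; linarith
      intro h0
      have hζ : riemannZeta (σ : ℂ) ≠ 0 := riemannZeta_ne_zero_of_one_le_re (by simp [hσ.1])
      rw [riemannZeta_eq_inv_sub_mul hσ1, h0, mul_zero] at hζ
      exact hζ rfl
  -- continuity of `ζ₁'/ζ₁` along the segment, hence a bound `K₀`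
  have hcont : ContinuousOn (fun σ : ℝ ↦ logDeriv riemannZeta₁ (σ : ℂ)) (Icc 1 2) := by
    intro σ hσ
    have h1 : ContinuousAt (fun s : ℂ ↦ logDeriv riemannZeta₁ s) (σ : ℂ) := by
      have hd : ContinuousAt (deriv riemannZeta₁) (σ : ℂ) :=
        (differentiable_riemannZeta₁.analyticAt (σ : ℂ)).deriv.continuousAt
      exact hd.div differentiable_riemannZeta₁.continuous.continuousAt (hne σ hσ)
    exact (h1.comp continuous_ofReal.continuousAt).continuousWithinAt
  obtain ⟨K₀, hK₀⟩ := isCompact_Icc.exists_bound_of_continuousOn hcont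
  refine ⟨max K₀ 0, le_max_right _ _, fun σ hσ1 hσ2 ↦ ?_⟩
  have hσ0 : 0 < σ := by linarith
  have hsc : 1 < (σ : ℂ).re := by simp [hσ1]
  have hσne : (σ : ℂ) ≠ 1 := by
    intro h1; have := congrArg re h1; simp at this; linarith
  -- the real series and the complex L-series
  have hsumC : Summable (LSeries.term (fun n ↦ (Λ n : ℂ)) (σ : ℂ)) :=
    ArithmeticFunction.LSeriesSummable_vonMangoldt hsc
  have hterm : LSeries.term (fun n ↦ (Λ n : ℂ)) (σ : ℂ) = fun n ↦ ((Λ n / (n : ℝ) ^ σ : ℝ) : ℂ) :=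
    funext (term_vonMangoldt_ofReal hσ0)
  rw [hterm] at hsumC
  have hsumR : Summable (fun n : ℕ ↦ Λ n / (n : ℝ) ^ σ) := Complex.summable_ofReal.1 hsumC
  refine ⟨hsumR, ?_⟩
  -- value: `L(Λ, σ) = −ζ'/ζ(σ)`
  have hL : ((∑' n : ℕ, Λ n / (n : ℝ) ^ σ : ℝ) : ℂ) =
      -deriv riemannZeta σ / riemannZeta σ := by
    rw [ofReal_tsum, ← ArithmeticFunction.LSeries_vonMangoldt_eq_deriv_riemannZeta_div hsc,
      LSeries, hterm]
  -- `−ζ'/ζ(σ) = 1/(σ−1) − ζ₁'/ζ₁(σ)`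
  have hζ : riemannZeta (σ : ℂ) ≠ 0 := riemannZeta_ne_zero_of_one_le_re (by simp [hσ1.le])
  have hlog : logDeriv riemannZeta (σ : ℂ) = logDeriv riemannZeta₁ σ - ((σ : ℂ) - 1)⁻¹ := by
    have hev : riemannZeta₁ =ᶠ[𝓝 (σ : ℂ)] fun w ↦ (w - 1) * riemannZeta w := by
      filter_upwards [isOpen_ne.mem_nhds hσne] with w hw
      rw [riemannZeta_eq_inv_sub_mul hw, ← mul_assoc, mul_inv_cancel₀ (sub_ne_zero.mpr hw),
        one_mul]
    have h1 : logDeriv riemannZeta₁ (σ : ℂ) = logDeriv (fun w ↦ (w - 1) * riemannZeta w) σ := by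
      rw [logDeriv_apply, logDeriv_apply, hev.deriv_eq, hev.eq_of_nhds]
    rw [h1, logDeriv_mul (f := fun w : ℂ ↦ w - 1) (g := riemannZeta) (σ : ℂ) (sub_ne_zero.2 hσne)
      hζ (by fun_prop) (differentiableAt_riemannZeta hσne)]
    have : logDeriv (fun w : ℂ ↦ w - 1) σ = ((σ : ℂ) - 1)⁻¹ := by
      rw [logDeriv_apply, deriv_sub_const, deriv_id'', one_div]
    rw [this]
    ring
  have hval : (∑' n : ℕ, Λ n / (n : ℝ) ^ σ) = (-deriv riemannZeta σ / riemannZeta σ).re := by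
    rw [← hL, ofReal_re]
  rw [hval]
  refine (re_le_norm _).trans ?_
  rw [neg_div, norm_neg, ← logDeriv_apply, hlog]
  refine (norm_sub_le _ _).trans ?_
  have h1 : ‖((σ : ℂ) - 1)⁻¹‖ = 1 / (σ - 1) := by
    rw [norm_inv, show (σ : ℂ) - 1 = ((σ - 1 : ℝ) : ℂ) by push_cast; ring, norm_real,
      Real.norm_eq_abs, abs_of_pos (by linarith), one_div]
  rw [h1, add_comm]
  gcongr
  exact (hK₀ σ ⟨hσ1.le, hσ2⟩).trans (le_max_left _ _)

/-! ### The Perron sums at a half-integer `x = N + 1/2` -/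

section halfInteger

variable {N : ℕ} {x c : ℝ}

/-- Basic facts for `x = N + 1/2`, `N ≥ 3`, `c = 1 + 1/log x`: `x > 0`, `log x ≥ 1`, `1 < c ≤ 2`,
`x^c = e·x`, `⌊x⌋ = N`. [folklore] -/
lemma halfInt_facts (hN : 3 ≤ N) (hx : x = N + 1 / 2) (hc : c = 1 + 1 / Real.log x) :
    0 < x ∧ 1 ≤ Real.log x ∧ 1 < c ∧ c ≤ 2 ∧ x ^ c = Real.exp 1 * x ∧ ⌊x⌋₊ = N := by
  have hN' : (3 : ℝ) ≤ N := by exact_mod_cast hN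
  have hx0 : 0 < x := by rw [hx]; positivity
  have hx3 : Real.exp 1 ≤ x := by
    have := Real.exp_one_lt_d9
    rw [hx]; linarith
  have hlog : 1 ≤ Real.log x := by
    rw [← Real.log_exp 1]; exact Real.log_le_log (Real.exp_pos 1) hx3
  have hlog0 : 0 < Real.log x := by linarith
  refine ⟨hx0, hlog, by rw [hc]; simp [hlog0], ?_, ?_, ?_⟩
  · rw [hc]
    have : 1 / Real.log x ≤ 1 := by rw [div_le_one hlog0]; exact hlog
    linarith
  · rw [hc, Real.rpow_add hx0, Real.rpow_one, Real.rpow_def_of_pos hx0,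
      mul_one_div_cancel hlog0.ne', mul_comm]
  · rw [hx, Nat.floor_eq_iff (by positivity)]
    constructor <;> [linarith; linarith]

/-- The summand of the Perron error sum: `w(n) = Λ(n) (x/n)^c / |log(x/n)|` (`w(0) = 0`). [folklore] -/
lemma perronWeight_nonneg (x c : ℝ) (hx : 0 ≤ x) (n : ℕ) :
    0 ≤ Λ n * (x / n) ^ c / |Real.log (x / n)| :=
  div_nonneg (mul_nonneg vonMangoldt_nonneg (Real.rpow_nonneg (by positivity) _)) (abs_nonneg _)

/-- **`n < x`:** for `1 ≤ n ≤ N`, `Λ(n)(x/n)^c/|log(x/n)| ≤ e·x·Λ(n)·(1/n + 1/(x−n))`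
(`log(x/n) ≥ (x−n)/x`, `(x/n)^{c−1} ≤ x^{c−1} = e`). [folklore] -/
lemma perronWeight_le_of_le (hN : 3 ≤ N) (hx : x = N + 1 / 2) (hc : c = 1 + 1 / Real.log x)
    {n : ℕ} (hn1 : 1 ≤ n) (hnN : n ≤ N) :
    Λ n * (x / n) ^ c / |Real.log (x / n)| ≤
      Real.exp 1 * x * (Λ n * (1 / n + 1 / (x - n))) := by
  obtain ⟨hx0, hlog, hc1, _, hxc, _⟩ := halfInt_facts hN hx hc
  have hn0 : (0 : ℝ) < n := by exact_mod_cast hn1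
  have hnx : (n : ℝ) < x := by
    rw [hx]; have : (n : ℝ) ≤ N := by exact_mod_cast hnN
    linarith
  have hxn : 0 < x - n := by linarith
  set y : ℝ := x / n with hy
  have hy1 : 1 < y := by rw [hy, lt_div_iff₀ hn0]; linarith
  have hy0 : 0 < y := one_pos.trans hy1
  -- log y ≥ (x - n)/x
  have hlogy : (x - n) / x ≤ Real.log y := by
    have h := Real.log_le_sub_one_of_pos (inv_pos.2 hy0)
    rw [Real.log_inv] at h
    have : y⁻¹ = n / x := by rw [hy, inv_div]
    rw [this] at h
    have e : (x - n) / x = 1 - n / x := by field_simp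
    rw [e]; linarith
  have hlogpos : 0 < Real.log y := Real.log_pos hy1
  rw [abs_of_pos hlogpos]
  -- y^c ≤ y * e
  have hyc : y ^ c ≤ y * Real.exp 1 := by
    have h1 : y ^ c = y * y ^ (c - 1) := by
      conv_lhs => rw [show c = 1 + (c - 1) by ring, Real.rpow_add hy0, Real.rpow_one]
    rw [h1]
    refine mul_le_mul_of_nonneg_left ?_ hy0.le
    have h2 : y ^ (c - 1) ≤ x ^ (c - 1) := by
      refine Real.rpow_le_rpow hy0.le ?_ (by linarith)
      rw [hy, div_le_iff₀ hn0]
      have : (1 : ℝ) ≤ n := by exact_mod_cast hn1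
      nlinarith
    have h3 : x ^ (c - 1) = Real.exp 1 := by
      have : x ^ c = x ^ (c - 1) * x := by
        conv_lhs => rw [show c = (c - 1) + 1 by ring, Real.rpow_add hx0, Real.rpow_one]
      rw [this] at hxc
      exact mul_right_cancel₀ hx0.ne' hxc
    rw [← h3]; exact h2
  -- combine
  have hΛ : 0 ≤ Λ n := vonMangoldt_nonneg
  calc Λ n * y ^ c / Real.log y ≤ Λ n * (y * Real.exp 1) / ((x - n) / x) :=
        div_le_div₀ (by positivity) (mul_le_mul_of_nonneg_left hyc hΛ) (by positivity) hlogy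
    _ = Real.exp 1 * x * (Λ n * (1 / n + 1 / (x - n))) := by
        rw [hy]
        field_simp
        ring

/-- **`n > x`:** for `n ≥ N + 1`, `Λ(n)(x/n)^c/|log(x/n)| ≤ x·Λ(n)/(n − x)`
(`log(n/x) ≥ (n−x)/n`, `(x/n)^c ≤ x/n`). [folklore] -/
lemma perronWeight_le_of_lt (hN : 3 ≤ N) (hx : x = N + 1 / 2) (hc : c = 1 + 1 / Real.log x)
    {n : ℕ} (hn : N + 1 ≤ n) :
    Λ n * (x / n) ^ c / |Real.log (x / n)| ≤ x * (Λ n / (n - x)) := by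
  obtain ⟨hx0, hlog, hc1, _, _, _⟩ := halfInt_facts hN hx hc
  have hxn : x < n := by
    rw [hx]; have : (N : ℝ) + 1 ≤ n := by exact_mod_cast hn
    linarith
  have hn0 : (0 : ℝ) < n := hx0.trans hxn
  have hnx : 0 < (n : ℝ) - x := by linarith
  set y : ℝ := x / n with hy
  have hy0 : 0 < y := div_pos hx0 hn0
  have hy1 : y < 1 := by rw [hy, div_lt_one hn0]; exact hxn
  -- |log y| = -log y ≥ (n - x)/n
  have hlogy : Real.log y ≤ -((n - x) / n) := by
    have h := Real.log_le_sub_one_of_pos hy0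
    have e : -(((n : ℝ) - x) / n) = x / n - 1 := by field_simp; ring
    rw [e, ← hy]; exact h
  have hlogneg : Real.log y < 0 := Real.log_neg hy0 hy1
  rw [abs_of_neg hlogneg]
  have hyc : y ^ c ≤ y := by
    have := Real.rpow_le_rpow_of_exponent_ge hy0 hy1.le hc1.le
    rwa [Real.rpow_one] at this
  have hΛ : 0 ≤ Λ n := vonMangoldt_nonneg
  calc Λ n * y ^ c / -Real.log y ≤ Λ n * y / ((n - x) / n) :=
        div_le_div₀ (by positivity) (mul_le_mul_of_nonneg_left hyc hΛ) (by positivity)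
          (by linarith)
    _ = x * (Λ n / (n - x)) := by
        rw [hy]
        field_simp

/-- **`n ≥ 2x`:** for `n ≥ 2N + 2`, `Λ(n)(x/n)^c/|log(x/n)| ≤ (e·x/log 2)·Λ(n)/n^c`
(`log(n/x) ≥ log 2`, `(x/n)^c = e x/n^c`). [folklore] -/
lemma perronWeight_le_of_two_mul_le (hN : 3 ≤ N) (hx : x = N + 1 / 2)
    (hc : c = 1 + 1 / Real.log x) {n : ℕ} (hn : 2 * N + 2 ≤ n) :
    Λ n * (x / n) ^ c / |Real.log (x / n)| ≤
      Real.exp 1 * x / Real.log 2 * (Λ n / (n : ℝ) ^ c) := by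
  obtain ⟨hx0, hlog, hc1, _, hxc, _⟩ := halfInt_facts hN hx hc
  have h2xn : 2 * x ≤ n := by
    rw [hx]; have : (2 : ℝ) * N + 2 ≤ n := by exact_mod_cast hn
    linarith
  have hn0 : (0 : ℝ) < n := by linarith
  set y : ℝ := x / n with hy
  have hy0 : 0 < y := div_pos hx0 hn0
  have hy2 : y ≤ 1 / 2 := by rw [hy, div_le_iff₀ hn0]; linarith
  have hlogy : Real.log y ≤ -Real.log 2 := by
    have := Real.log_le_log hy0 hy2
    rwa [one_div, Real.log_inv] at this
  have hlog2 : 0 < Real.log 2 := Real.log_pos one_lt_two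
  have hlogneg : Real.log y < 0 := by linarith
  rw [abs_of_neg hlogneg]
  have hyc : y ^ c = Real.exp 1 * x / (n : ℝ) ^ c := by
    rw [hy, Real.div_rpow hx0.le hn0.le, hxc]
  have hΛ : 0 ≤ Λ n := vonMangoldt_nonneg
  calc Λ n * y ^ c / -Real.log y ≤ Λ n * y ^ c / Real.log 2 :=
        div_le_div_of_nonneg_left (by positivity) hlog2 (by linarith)
    _ = Real.exp 1 * x / Real.log 2 * (Λ n / (n : ℝ) ^ c) := by
        rw [hyc]
        field_simp

/-- Harmonic sums: `∑_{n=1}^{N} 1/n ≤ 1 + log N` (Mathlib's `harmonic_le_one_add_log`). [folklore] -/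
lemma sum_Ico_one_div_le (N : ℕ) :
    ∑ n ∈ Finset.Ico 1 (N + 1), (1 / (n : ℝ)) ≤ 1 + Real.log N := by
  have h := harmonic_le_one_add_log N
  have e : ((harmonic N : ℚ) : ℝ) = ∑ n ∈ Finset.Ico 1 (N + 1), (1 / (n : ℝ)) := by
    rw [harmonic, Finset.sum_Ico_eq_sum_range]
    push_cast
    refine Finset.sum_congr (by simp) fun i _ ↦ ?_
    ring
  rw [← e]; exact h

/-- Shifted harmonic sums: `∑_{k=0}^{M-1} 1/(k + 1/2) ≤ 2(1 + log M)` (`1/(k+1/2) ≤ 2/(k+1)`). [folklore] -/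
lemma sum_range_one_div_add_half_le (M : ℕ) :
    ∑ k ∈ Finset.range M, (1 / ((k : ℝ) + 1 / 2)) ≤ 2 * (1 + Real.log M) := by
  have h1 : ∑ k ∈ Finset.range M, (1 / ((k : ℝ) + 1 / 2)) ≤
      ∑ k ∈ Finset.range M, 2 * (1 / ((k : ℝ) + 1)) := by
    refine Finset.sum_le_sum fun k _ ↦ ?_
    rw [mul_one_div, div_le_div_iff₀ (by positivity) (by positivity)]
    linarith
  refine h1.trans ?_
  rw [← Finset.mul_sum]
  refine mul_le_mul_of_nonneg_left ?_ (by norm_num)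
  have h2 : ∑ k ∈ Finset.range M, (1 / ((k : ℝ) + 1)) = ∑ n ∈ Finset.Ico 1 (M + 1), (1 / (n : ℝ)) := by
    rw [Finset.sum_Ico_eq_sum_range]
    refine Finset.sum_congr (by simp) fun i _ ↦ ?_
    push_cast; ring
  rw [h2]; exact sum_Ico_one_div_le M

/-- The block `1 ≤ n ≤ N`: `∑ Λ(n)(1/n + 1/(x−n)) ≤ log N · (3 + 3 log N)`. [folklore] -/
lemma sum_block_one (hN : 3 ≤ N) (hx : x = N + 1 / 2) :
    ∑ n ∈ Finset.Ico 1 (N + 1), Λ n * (1 / n + 1 / (x - n)) ≤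
      Real.log N * (3 * (1 + Real.log N)) := by
  have hN1 : 1 ≤ N := le_trans (by norm_num) hN
  have hlogN : 0 ≤ Real.log N := Real.log_natCast_nonneg N
  -- Λ n ≤ log N on the block
  have hΛ : ∀ n ∈ Finset.Ico 1 (N + 1), Λ n ≤ Real.log N := by
    intro n hn
    rw [Finset.mem_Ico] at hn
    refine vonMangoldt_le_log.trans (Real.log_le_log (by exact_mod_cast hn.1) ?_)
    exact_mod_cast Nat.lt_succ_iff.1 hn.2
  have hpos : ∀ n ∈ Finset.Ico 1 (N + 1), 0 ≤ (1 / (n : ℝ) + 1 / (x - n)) := by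
    intro n hn
    rw [Finset.mem_Ico] at hn
    have h1 : (0 : ℝ) < n := by exact_mod_cast hn.1
    have h2 : 0 < x - n := by
      rw [hx]; have : (n : ℝ) ≤ N := by exact_mod_cast Nat.lt_succ_iff.1 hn.2
      linarith
    positivity
  calc ∑ n ∈ Finset.Ico 1 (N + 1), Λ n * (1 / n + 1 / (x - n))
      ≤ ∑ n ∈ Finset.Ico 1 (N + 1), Real.log N * (1 / n + 1 / (x - n)) :=
        Finset.sum_le_sum fun n hn ↦ mul_le_mul_of_nonneg_right (hΛ n hn) (hpos n hn)
    _ = Real.log N * (∑ n ∈ Finset.Ico 1 (N + 1), (1 / (n : ℝ)) +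
          ∑ n ∈ Finset.Ico 1 (N + 1), (1 / (x - n))) := by
        rw [← Finset.mul_sum, Finset.sum_add_distrib]
    _ ≤ Real.log N * ((1 + Real.log N) + 2 * (1 + Real.log N)) := by
        gcongr
        · exact sum_Ico_one_div_le N
        · -- reflect: x - n = (N - n) + 1/2, n = 1..N ↦ k = N - n = 0..N-1
          have e : ∑ n ∈ Finset.Ico 1 (N + 1), (1 / (x - n)) =
              ∑ k ∈ Finset.range N, (1 / ((k : ℝ) + 1 / 2)) := by
            rw [Finset.sum_Ico_eq_sum_range, show N + 1 - 1 = N from rfl,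
              ← Finset.sum_range_reflect _ N]
            refine Finset.sum_congr rfl fun j hj ↦ ?_
            rw [Finset.mem_range] at hj
            have e1 : (((1 + (N - 1 - j)) : ℕ) : ℝ) = N - j := by
              rw [Nat.cast_add, Nat.cast_sub (by omega), Nat.cast_sub (by omega)]
              push_cast; ring
            rw [hx, e1]
            ring
          rw [e]; exact sum_range_one_div_add_half_le N
    _ = Real.log N * (3 * (1 + Real.log N)) := by ring

/-- The block `N + 1 ≤ n ≤ 2N + 1`: `∑ Λ(n)/(n − x) ≤ log(2N+1) · 2(1 + log(N+1))`. [folklore] -/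
lemma sum_block_two (hx : x = N + 1 / 2) :
    ∑ n ∈ Finset.Ico (N + 1) (2 * N + 2), Λ n / (n - x) ≤
      Real.log (2 * N + 1) * (2 * (1 + Real.log (N + 1))) := by
  have hΛ : ∀ n ∈ Finset.Ico (N + 1) (2 * N + 2), Λ n ≤ Real.log (2 * N + 1) := by
    intro n hn
    rw [Finset.mem_Ico] at hn
    refine vonMangoldt_le_log.trans (Real.log_le_log (by exact_mod_cast (show 0 < n by omega)) ?_)
    exact_mod_cast (show n ≤ 2 * N + 1 by omega)
  have hpos : ∀ n ∈ Finset.Ico (N + 1) (2 * N + 2), 0 < (n : ℝ) - x := by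
    intro n hn
    rw [Finset.mem_Ico] at hn
    rw [hx]; have : (N : ℝ) + 1 ≤ n := by exact_mod_cast hn.1
    linarith
  calc ∑ n ∈ Finset.Ico (N + 1) (2 * N + 2), Λ n / (n - x)
      ≤ ∑ n ∈ Finset.Ico (N + 1) (2 * N + 2), Real.log (2 * N + 1) * (1 / (n - x)) :=
        Finset.sum_le_sum fun n hn ↦ by
          rw [mul_one_div]
          exact div_le_div_of_nonneg_right (hΛ n hn) (hpos n hn).le
    _ = Real.log (2 * N + 1) * ∑ k ∈ Finset.range (N + 1), (1 / ((k : ℝ) + 1 / 2)) := by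
        rw [Finset.mul_sum, Finset.sum_Ico_eq_sum_range, show 2 * N + 2 - (N + 1) = N + 1 by omega]
        refine Finset.sum_congr rfl fun k _ ↦ ?_
        rw [hx]; push_cast; ring
    _ ≤ Real.log (2 * N + 1) * (2 * (1 + Real.log (N + 1))) := by
        have h := sum_range_one_div_add_half_le (N + 1)
        push_cast at h
        exact mul_le_mul_of_nonneg_left h (Real.log_nonneg (by
          have : (0 : ℝ) ≤ N := Nat.cast_nonneg N; linarith))

/-- **The Perron error sum at a half-integer.** There is an absolute `K` such that for `N ≥ 3`,
`x = N + 1/2`, `c = 1 + 1/log x` and every finite set `s` of positive integers,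
`∑_{n ∈ s} Λ(n) (x/n)^c/|log(x/n)| ≤ K x log² x` (Montgomery–Vaughan Cor. 5.3 with `T ≍ x`:
`∑_{x/2<n<2x} Λ(n) min(1, x/(T|x−n|)) + (x^c/T)∑ Λ(n)n^{-c} ≪ log² x`, times `T ≍ x`).
[cite: MontgomeryVaughan2007, Cor. 5.3] -/
theorem exists_perronSum_le :
    ∃ K : ℝ, 0 < K ∧ ∀ N : ℕ, 3 ≤ N → ∀ x c : ℝ, x = N + 1 / 2 → c = 1 + 1 / Real.log x →
      ∀ s : Finset ℕ, ∑ n ∈ s, Λ n * (x / n) ^ c / |Real.log (x / n)| ≤ K * x * Real.log x ^ 2 := by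
  obtain ⟨K₀, hK₀0, hK₀⟩ := exists_tsum_vonMangoldt_div_rpow_le
  set K : ℝ := 6 * Real.exp 1 + 12 + Real.exp 1 / Real.log 2 * (1 + K₀) with hK
  have hlog2 : 0 < Real.log 2 := Real.log_pos one_lt_two
  refine ⟨K, by positivity, fun N hN x c hx hc s ↦ ?_⟩
  classical
  obtain ⟨hx0, hlog, hc1, hc2, hxc, _⟩ := halfInt_facts hN hx hc
  have hN' : (3 : ℝ) ≤ N := by exact_mod_cast hN
  have hlogx0 : 0 < Real.log x := by linarith
  set w : ℕ → ℝ := fun n ↦ Λ n * (x / n) ^ c / |Real.log (x / n)| with hw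
  have hw0 : ∀ n, 0 ≤ w n := fun n ↦ perronWeight_nonneg x c hx0.le n
  -- split `s` at `2N + 2`
  have hsplit : ∑ n ∈ s, w n ≤ ∑ n ∈ Finset.range (2 * N + 2), w n +
      ∑ n ∈ s.filter (fun n ↦ 2 * N + 2 ≤ n), w n := by
    rw [← Finset.sum_filter_add_sum_filter_not s (fun n ↦ n < 2 * N + 2)]
    refine add_le_add ?_ ?_
    · refine Finset.sum_le_sum_of_subset_of_nonneg ?_ fun n _ _ ↦ hw0 n
      intro n hn
      rw [Finset.mem_filter] at hn
      exact Finset.mem_range.2 hn.2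
    · refine le_of_eq (Finset.sum_congr ?_ fun _ _ ↦ rfl)
      ext n; simp [not_lt]
  -- the finite part
  have hlogN : Real.log N ≤ Real.log x := Real.log_le_log (by positivity) (by rw [hx]; linarith)
  have hlogN0 : 0 ≤ Real.log N := Real.log_natCast_nonneg N
  have hlog2N : Real.log (2 * N + 1) ≤ 2 * Real.log x := by
    have e : (2 : ℝ) * N + 1 = 2 * x := by rw [hx]; ring
    rw [e, Real.log_mul two_ne_zero hx0.ne']
    have : Real.log 2 < 1 := by
      have := Real.log_two_lt_d9; linarith
    linarith
  have hlogN1 : Real.log (N + 1) ≤ 2 * Real.log x := by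
    have h1 : (N : ℝ) + 1 ≤ 2 * N + 1 := by linarith
    exact le_trans (Real.log_le_log (by positivity) h1) hlog2N
  have hfin : ∑ n ∈ Finset.range (2 * N + 2), w n ≤ (6 * Real.exp 1 + 12) * x * Real.log x ^ 2 := by
    rw [Finset.range_eq_Ico, ← Finset.sum_Ico_consecutive _ (Nat.zero_le 1) (by omega : 1 ≤ 2 * N + 2),
      ← Finset.sum_Ico_consecutive _ (by omega : 1 ≤ N + 1) (by omega : N + 1 ≤ 2 * N + 2)]
    have h0 : ∑ n ∈ Finset.Ico 0 1, w n = 0 := by simp [hw]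
    have h1 : ∑ n ∈ Finset.Ico 1 (N + 1), w n ≤ 6 * Real.exp 1 * x * Real.log x ^ 2 := by
      calc ∑ n ∈ Finset.Ico 1 (N + 1), w n
          ≤ ∑ n ∈ Finset.Ico 1 (N + 1), Real.exp 1 * x * (Λ n * (1 / n + 1 / (x - n))) :=
            Finset.sum_le_sum fun n hn ↦ by
              rw [Finset.mem_Ico] at hn
              exact perronWeight_le_of_le hN hx hc hn.1 (Nat.lt_succ_iff.1 hn.2)
        _ = Real.exp 1 * x * ∑ n ∈ Finset.Ico 1 (N + 1), Λ n * (1 / n + 1 / (x - n)) := by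
            rw [Finset.mul_sum]
        _ ≤ Real.exp 1 * x * (Real.log N * (3 * (1 + Real.log N))) :=
            mul_le_mul_of_nonneg_left (sum_block_one hN hx) (by positivity)
        _ ≤ Real.exp 1 * x * (Real.log x * (3 * (Real.log x + Real.log x))) := by
            refine mul_le_mul_of_nonneg_left ?_ (by positivity)
            exact mul_le_mul hlogN (by linarith) (by positivity) hlogx0.le
        _ = 6 * Real.exp 1 * x * Real.log x ^ 2 := by ring
    have h2 : ∑ n ∈ Finset.Ico (N + 1) (2 * N + 2), w n ≤ 12 * x * Real.log x ^ 2 := by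
      calc ∑ n ∈ Finset.Ico (N + 1) (2 * N + 2), w n
          ≤ ∑ n ∈ Finset.Ico (N + 1) (2 * N + 2), x * (Λ n / (n - x)) :=
            Finset.sum_le_sum fun n hn ↦ by
              rw [Finset.mem_Ico] at hn
              exact perronWeight_le_of_lt hN hx hc hn.1
        _ = x * ∑ n ∈ Finset.Ico (N + 1) (2 * N + 2), Λ n / (n - x) := by rw [Finset.mul_sum]
        _ ≤ x * (Real.log (2 * N + 1) * (2 * (1 + Real.log (N + 1)))) :=
            mul_le_mul_of_nonneg_left (sum_block_two hx) hx0.le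
        _ ≤ x * ((2 * Real.log x) * (2 * (Real.log x + 2 * Real.log x))) := by
            refine mul_le_mul_of_nonneg_left ?_ hx0.le
            have hA : 0 ≤ Real.log ((N : ℝ) + 1) := Real.log_nonneg (by linarith)
            refine mul_le_mul hlog2N (by linarith) (by positivity) (by positivity)
        _ = 12 * x * Real.log x ^ 2 := by ring
    linarith [h0, h1, h2]
  -- the tail
  obtain ⟨hsum, htsum⟩ := hK₀ c hc1 hc2
  have hc1' : 1 / (c - 1) = Real.log x := by rw [hc, add_sub_cancel_left, one_div_one_div]
  have htail : ∑ n ∈ s.filter (fun n ↦ 2 * N + 2 ≤ n), w n ≤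
      Real.exp 1 / Real.log 2 * (1 + K₀) * x * Real.log x ^ 2 := by
    calc ∑ n ∈ s.filter (fun n ↦ 2 * N + 2 ≤ n), w n
        ≤ ∑ n ∈ s.filter (fun n ↦ 2 * N + 2 ≤ n), Real.exp 1 * x / Real.log 2 * (Λ n / (n : ℝ) ^ c) :=
          Finset.sum_le_sum fun n hn ↦ by
            rw [Finset.mem_filter] at hn
            exact perronWeight_le_of_two_mul_le hN hx hc hn.2
      _ = Real.exp 1 * x / Real.log 2 * ∑ n ∈ s.filter (fun n ↦ 2 * N + 2 ≤ n), Λ n / (n : ℝ) ^ c := by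
          rw [Finset.mul_sum]
      _ ≤ Real.exp 1 * x / Real.log 2 * (∑' n : ℕ, Λ n / (n : ℝ) ^ c) := by
          refine mul_le_mul_of_nonneg_left (hsum.sum_le_tsum _ fun n _ ↦ ?_) (by positivity)
          exact div_nonneg vonMangoldt_nonneg (Real.rpow_nonneg (Nat.cast_nonneg n) _)
      _ ≤ Real.exp 1 * x / Real.log 2 * (Real.log x + K₀) := by
          rw [← hc1']; exact mul_le_mul_of_nonneg_left htsum (by positivity)
      _ ≤ Real.exp 1 * x / Real.log 2 * ((1 + K₀) * Real.log x ^ 2) := by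
          refine mul_le_mul_of_nonneg_left ?_ (by positivity)
          have h1 : Real.log x ≤ Real.log x ^ 2 := by nlinarith
          have h2 : K₀ ≤ K₀ * Real.log x ^ 2 := by nlinarith
          nlinarith
      _ = Real.exp 1 / Real.log 2 * (1 + K₀) * x * Real.log x ^ 2 := by ring
  calc ∑ n ∈ s, w n ≤ _ := hsplit
    _ ≤ (6 * Real.exp 1 + 12) * x * Real.log x ^ 2 +
          Real.exp 1 / Real.log 2 * (1 + K₀) * x * Real.log x ^ 2 := add_le_add hfin htail
    _ = K * x * Real.log x ^ 2 := by rw [hK]; ring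

end halfInteger

/-! ### The right edge of the contour: termwise integration and Perron's kernel -/

section rightEdge

variable {N : ℕ} {x c : ℝ}

/-- Continuity in `t` of the `n`-th term `Λ(n)(x/n)^{c+it}/(c+it)`. [folklore] -/
lemma continuous_perronTerm (hx : 0 < x) (hc : 0 < c) (n : ℕ) :
    Continuous fun t : ℝ ↦
      (Λ n : ℂ) * ((((x / n : ℝ)) : ℂ) ^ ((c : ℂ) + t * I) / ((c : ℂ) + t * I)) := by
  rcases Nat.eq_zero_or_pos n with rfl | hn
  · simp only [ArithmeticFunction.map_zero, ofReal_zero, zero_mul]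
    exact continuous_const
  · have hn' : (0 : ℝ) < n := by exact_mod_cast hn
    exact continuous_const.mul (continuous_cpow_div_vertical (div_pos hx hn') hc.ne')

/-- The `n`-th term is bounded by `Λ(n)(x/n)^c/c` on the line `Re s = c > 0`. [folklore] -/
lemma norm_perronTerm_le (hx : 0 < x) (hc : 0 < c) (n : ℕ) (t : ℝ) :
    ‖(Λ n : ℂ) * ((((x / n : ℝ)) : ℂ) ^ ((c : ℂ) + t * I) / ((c : ℂ) + t * I))‖ ≤
      Λ n * (x / n) ^ c / c := by
  rcases Nat.eq_zero_or_pos n with rfl | hn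
  · simp
  · rw [norm_mul, Complex.norm_real, Real.norm_eq_abs, abs_of_nonneg vonMangoldt_nonneg,
      mul_div_assoc]
    refine mul_le_mul_of_nonneg_left ?_ vonMangoldt_nonneg
    have hn' : (0 : ℝ) < n := by exact_mod_cast hn
    have := norm_cpow_div_le_vertical (div_pos hx hn') hc.ne' t
    rwa [abs_of_pos hc] at this

/-- A half-integer is not an integer: `x/n ≠ 1` for `x = N + 1/2`. [folklore] -/
lemma halfInt_div_ne_one (hx : x = N + 1 / 2) (n : ℕ) : x / n ≠ 1 := by
  intro h
  rcases Nat.eq_zero_or_pos n with rfl | hn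
  · simp at h
  · have hn' : (0 : ℝ) < n := by exact_mod_cast hn
    rw [div_eq_one_iff_eq hn'.ne', hx] at h
    have h2 : (2 * N + 1 : ℝ) = 2 * n := by linarith
    have h3 : 2 * N + 1 = 2 * n := by exact_mod_cast h2
    omega

/-- **The truncated Perron formula for `ψ` at half-integers** (Montgomery–Vaughan Thm. 5.2 /
Cor. 5.3 with `a_n = Λ(n)`, `σ₀ = 1 + 1/log x`, `T ≍ x`). There is an absolute `K` such that for
`N ≥ 3`, `x = N + 1/2`, `c = 1 + 1/log x` and `T₁, T₂ ≥ x`,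
`‖∫_{-T₂}^{T₁} (−ζ'/ζ)(c+it) x^{c+it}/(c+it) dt − 2π ψ(x)‖ ≤ K log² x`, i.e.
`ψ(x) = (1/2πi) ∫_{c−iT₂}^{c+iT₁} (−ζ'/ζ)(s) x^s ds/s + O(log² x)`.
[cite: MontgomeryVaughan2007, Cor. 5.3] -/
theorem exists_norm_perron_vonMangoldt_sub_le :
    ∃ K : ℝ, 0 < K ∧ ∀ N : ℕ, 3 ≤ N → ∀ x c : ℝ, x = N + 1 / 2 → c = 1 + 1 / Real.log x →
      ∀ T₁ T₂ : ℝ, x ≤ T₁ → x ≤ T₂ →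
        ‖(∫ t in (-T₂)..T₁, (-deriv riemannZeta (c + t * I) / riemannZeta (c + t * I)) *
              ((x : ℂ) ^ ((c : ℂ) + t * I) / ((c : ℂ) + t * I))) - 2 * π * ψ x‖ ≤
          K * Real.log x ^ 2 := by
  obtain ⟨K, hK0, hK⟩ := exists_perronSum_le
  obtain ⟨K₀, _, hK₀⟩ := exists_tsum_vonMangoldt_div_rpow_le
  refine ⟨2 * K, by positivity, fun N hN x c hx hc T₁ T₂ hT₁ hT₂ ↦ ?_⟩
  classical
  obtain ⟨hx0, hlog, hc1, hc2, hxc, hfloor⟩ := halfInt_facts hN hx hc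
  have hc0 : 0 < c := by linarith
  have hT₁0 : 0 < T₁ := hx0.trans_le hT₁
  have hT₂0 : 0 < T₂ := hx0.trans_le hT₂
  set F : ℕ → ℝ → ℂ := fun n t ↦
    (Λ n : ℂ) * ((((x / n : ℝ)) : ℂ) ^ ((c : ℂ) + t * I) / ((c : ℂ) + t * I)) with hF
  set f : ℝ → ℂ := fun t ↦ (-deriv riemannZeta (c + t * I) / riemannZeta (c + t * I)) *
    ((x : ℂ) ^ ((c : ℂ) + t * I) / ((c : ℂ) + t * I)) with hf
  set w : ℕ → ℝ := fun n ↦ Λ n * (x / n) ^ c / |Real.log (x / n)| with hw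
  -- summability of the dominating series `Λ(n)(x/n)^c/c = (x^c/c) Λ(n)/n^c`
  obtain ⟨hsumc, -⟩ := hK₀ c hc1 hc2
  have hbsum : Summable fun n : ℕ ↦ Λ n * (x / n) ^ c / c := by
    have := hsumc.mul_left (x ^ c / c)
    refine this.congr fun n ↦ ?_
    rw [Real.div_rpow hx0.le (Nat.cast_nonneg n)]
    field_simp
  -- (1) termwise integration
  have hDCT : HasSum (fun n ↦ ∫ t in (-T₂)..T₁, F n t) (∫ t in (-T₂)..T₁, f t) := by
    refine intervalIntegral.hasSum_integral_of_dominated_convergence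
      (fun n _ ↦ Λ n * (x / n) ^ c / c)
      (fun n ↦ (continuous_perronTerm hx0 hc0 n).aestronglyMeasurable)
      (fun n ↦ Eventually.of_forall fun t _ ↦ norm_perronTerm_le hx0 hc0 n t)
      (Eventually.of_forall fun t _ ↦ hbsum) intervalIntegrable_const
      (Eventually.of_forall fun t _ ↦ ?_)
    have hs : 1 < ((c : ℂ) + t * I).re := by simp; linarith
    have h := hasSum_vonMangoldt_mul_cpow_div hx0 hs
    exact h
  -- (2) the integrals of the terms
  have hFint : ∀ n, ∫ t in (-T₂)..T₁, F n t = (Λ n : ℂ) *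
      ∫ t in (-T₂)..T₁, ((((x / n : ℝ)) : ℂ) ^ ((c : ℂ) + t * I) / ((c : ℂ) + t * I)) :=
    fun n ↦ intervalIntegral.integral_const_mul _ _
  -- (3) the main part: a finite sum equal to `2π ψ(x)`
  set ind : ℕ → ℂ := fun n ↦ (Λ n : ℂ) * ((if 1 < x / n then 2 * π else 0 : ℝ) : ℂ) with hind_def
  have hind0 : ∀ n ∉ Finset.range (N + 1), ind n = 0 := by
    intro n hn
    rw [Finset.mem_range, not_lt] at hn
    have hxn : x / n < 1 := by
      have hn' : (N : ℝ) + 1 ≤ n := by exact_mod_cast hn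
      rw [div_lt_one (by linarith)]; rw [hx]; linarith
    simp [hind_def, not_lt.2 hxn.le]
  have hind : HasSum ind (2 * π * ψ x) := by
    have h : HasSum ind (∑ n ∈ Finset.range (N + 1), ind n) := hasSum_sum_of_ne_finset_zero hind0
    have hval : ∑ n ∈ Finset.range (N + 1), ind n = 2 * π * ψ x := by
      have h1 : ∀ n ∈ Finset.range (N + 1), ind n = 2 * π * (Λ n : ℂ) := by
        intro n hn
        rw [Finset.mem_range] at hn
        rcases Nat.eq_zero_or_pos n with rfl | hn0
        · simp [hind_def]
        · have hxn : 1 < x / n := by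
            have hn' : (0 : ℝ) < n := by exact_mod_cast hn0
            have hn'' : (n : ℝ) ≤ N := by exact_mod_cast Nat.lt_succ_iff.1 hn
            rw [lt_div_iff₀ hn', hx]; linarith
          simp only [hind_def, if_pos hxn]
          push_cast; ring
      rw [Finset.sum_congr rfl h1, ← Finset.mul_sum]
      congr 1
      have hIco : Finset.Ico 1 (N + 1) = Finset.Ioc 0 N := by
        ext n; simp only [Finset.mem_Ico, Finset.mem_Ioc]; omega
      rw [Chebyshev.psi, hfloor, Finset.range_eq_Ico,
        Finset.sum_eq_sum_Ico_succ_bot (Nat.succ_pos N), hIco, ofReal_sum]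
      simp
    rwa [hval] at h
  -- (4) termwise error
  have herr : ∀ n, ‖(∫ t in (-T₂)..T₁, F n t) - ind n‖ ≤ 2 / x * w n := by
    intro n
    rcases Nat.eq_zero_or_pos n with rfl | hn0
    · simp [hFint, hind_def, hw]
    · have hn' : (0 : ℝ) < n := by exact_mod_cast hn0
      have hy0 : 0 < x / n := div_pos hx0 hn'
      have hP := norm_perronIntegral_sub_le hy0 (halfInt_div_ne_one hx n) hc0 hT₁0 hT₂0
      rw [hFint, hind_def, ← mul_sub, norm_mul, Complex.norm_real, Real.norm_eq_abs,
        abs_of_nonneg vonMangoldt_nonneg]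
      calc Λ n * ‖(∫ t in (-T₂)..T₁, ((((x / n : ℝ)) : ℂ) ^ ((c : ℂ) + t * I) / ((c : ℂ) + t * I))) -
              ((if 1 < x / n then 2 * π else 0 : ℝ) : ℂ)‖
          ≤ Λ n * ((x / n) ^ c * (1 / T₁ + 1 / T₂) / |Real.log (x / n)|) :=
            mul_le_mul_of_nonneg_left hP vonMangoldt_nonneg
        _ ≤ Λ n * ((x / n) ^ c * (2 / x) / |Real.log (x / n)|) := by
            refine mul_le_mul_of_nonneg_left ?_ vonMangoldt_nonneg
            refine div_le_div_of_nonneg_right ?_ (abs_nonneg _)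
            refine mul_le_mul_of_nonneg_left ?_ (Real.rpow_nonneg hy0.le _)
            have h1 : 1 / T₁ ≤ 1 / x := one_div_le_one_div_of_le hx0 hT₁
            have h2 : 1 / T₂ ≤ 1 / x := one_div_le_one_div_of_le hx0 hT₂
            calc 1 / T₁ + 1 / T₂ ≤ 1 / x + 1 / x := add_le_add h1 h2
              _ = 2 / x := by ring
        _ = 2 / x * w n := by rw [hw]; ring
  -- (5) summation
  have hwsum : Summable w := summable_of_sum_le (fun n ↦ perronWeight_nonneg x c hx0.le n)
    (hK N hN x c hx hc)
  have hwtsum : ∑' n, w n ≤ K * x * Real.log x ^ 2 :=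
    Real.tsum_le_of_sum_le (fun n ↦ perronWeight_nonneg x c hx0.le n) (hK N hN x c hx hc)
  have hg : HasSum (fun n ↦ 2 / x * w n) (2 / x * ∑' n, w n) := (hwsum.hasSum).mul_left _
  have hmain := (hDCT.sub hind).norm_le_of_bounded hg herr
  refine hmain.trans ?_
  calc 2 / x * ∑' n, w n ≤ 2 / x * (K * x * Real.log x ^ 2) :=
        mul_le_mul_of_nonneg_left hwtsum (by positivity)
    _ = 2 * K * Real.log x ^ 2 := by field_simp

end rightEdge

end Literature.NumberTheory.LFunctions

end
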